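import Summits.PneNP.PneNP.Theorems.SzkEntropyPeaWorstToAvgDualModeCompileAdviceElimBricks

/-!
# Route SzkEntropy, crux `PeaWorstToAvg` (stmt-PneNP-10777), line `dual-mode-compile`, stub `stub_adviceElim`:
# the bricks of the uniform scheme (II): parameters, sample blocks, padded queries, the error bit

Support file (5) for the stub `stub_adviceElim` (advice elimination by labelled self-testing): the middle
part of the uniform scheme `U` as a total `FP` string function.  On the machine word `w₀ = ⟨e, R⟩`
(`e = ⟨y, ⟨1ⁿ, 1ᵐ⟩⟩` the scheme word, `R` the coins) all integer parameters (`MParams.pm n m` of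
`…AdviceElimBricks.lean`) are polynomials of the length `ℓ = 2n + m + 4` of the STRIPPED word `⟨[], ⟨1ⁿ, 1ᵐ⟩⟩`
(`stripF`; so they do not depend on `y`) and of `n` (the samplers' budget `c(n)`), read off `e` in unary
(`nU`, `cnU`, `GU`, `PU`, `kU`, `NU`, `τU`, `kPU`, `LU`, `testLenU`).  Then, on the argument
`z = ⟨⟨w₀, 1ᶜ⟩, 1ⁱ⟩` of the error-count fold:

* `blkZ` — the sample block `blockAt c i R`; `instZ` — its labelled instance `S_b(1ⁿ; r)` (branch on the
  label bit between the two uniform samplers, `runStr`); `ampZ` — its amplification coins;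
* `qOfF` — the padded query word `⟨y', ⟨1ⁿ, 1^{G − |⟨y', ⟨1ⁿ, 1⁰⟩⟩|}⟩⟩ = schemeEnc (query G n y')`;
* **`errPieceZ`** — the error bit `[errBit c (blockAt c i R)]` of candidate `c` on sample `i`
  (`errPieceZ_apply`, `errPieceZ_mem_FP`, `oneBit_errPieceZ`).

References: S. Arora, B. Barak (2009), §1.3; A. Bogdanov, L. Trevisan (2006), Def. 2.12, Lemma 3.2 (padding);
R. Impagliazzo, A. Wigderson, JCSS 63 (2001), Lemma 14.
-/

noncomputable section

open _root_.Computability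
open Literature.Computability.Complexity Literature.Computability.Complexity.Brick
open Literature.Computability.Complexity.Plumb Literature.Computability.Complexity.HashBricks
open Literature.Computability.MetaComplexity
open Finset Polynomial

namespace Summit.PneNP.PneNP.Cruxes.PeaWorstToAvg.DualModeCompile

set_option linter.dupNamespace false -- `Summit.PneNP.PneNP.…`: summit = sub-problem name (D-0017 single-conjunct layout)

namespace AdviceElim

/-! ### Unary parameters read off the scheme word -/

variable (mp : MParams)

/-- `e ↦ 1ⁿ` (the middle component of the scheme word). [folklore] -/
def nU : List Bool → List Bool := fstF ∘ sndF

/-- `e ↦ ⟨[], ⟨1ⁿ, 1ᵐ⟩⟩`, the stripped scheme word (its length `2n + m + 4` drives the parameters). [folklore] -/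
def stripF : List Bool → List Bool := fanoutFn (fun _ => []) sndF

/-- `e ↦ 1^{c(n)}`. [folklore] -/
def cnU : List Bool → List Bool := polyFn mp.c ∘ nU

/-- `e ↦ 1^{G}`. [folklore] -/
def GU : List Bool → List Bool := polyFn mp.Gp ∘ stripF

/-- `e ↦ 1^{P}`. [folklore] -/
def PU : List Bool → List Bool := polyFn mp.Pp ∘ stripF

/-- `e ↦ 1^{k}`. [folklore] -/
def kU : List Bool → List Bool := polyFn mp.kp ∘ stripF

/-- `e ↦ 1^{N}`. [folklore] -/
def NU : List Bool → List Bool := polyFn mp.Np ∘ stripF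

/-- `e ↦ 1^{τ}`. [folklore] -/
def τU : List Bool → List Bool := polyFn mp.τp ∘ stripF

/-- `e ↦ 1^{k P}` (amplification coins per evaluation). [folklore] -/
def kPU : List Bool → List Bool := umulFn ∘ fanoutFn (kU mp) (PU mp)

/-- `e ↦ 1^{L}`, `L = 1 + c(n) + k P` (sample block length). [folklore] -/
def LU : List Bool → List Bool := fun e => true :: (cnU mp e ++ kPU mp e)

/-- `e ↦ 1^{(P+1) N L}` (test region length). [folklore] -/
def testLenU : List Bool → List Bool :=
  umulFn ∘ fanoutFn (umulFn ∘ fanoutFn (List.cons true ∘ PU mp) (NU mp)) (LU mp)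

section Values

variable (y : List Bool) (n m : ℕ)

/-- `1ⁿ` read off the scheme word. [folklore] -/
theorem nU_schemeEnc : nU (schemeEnc (y, n, m)) = ones n := by
  simp [nU, schemeEnc, OracleCompose.unaryEncodeNat_eq_replicate]

/-- The first component of the scheme word. [folklore] -/
theorem fstF_schemeEnc : fstF (schemeEnc (y, n, m)) = y := by
  simp [schemeEnc]

/-- The stripped scheme word. [folklore] -/
theorem stripF_schemeEnc : stripF (schemeEnc (y, n, m)) = schemeEnc (([] : List Bool), n, m) := by
  simp [stripF, schemeEnc]

/-- `1^{c(n)}`. [folklore] -/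
theorem cnU_schemeEnc : cnU mp (schemeEnc (y, n, m)) = ones (mp.pm n m).cn := by
  simp [cnU, nU_schemeEnc, MParams.pm, MParams.params]

/-- `1^G`. [folklore] -/
theorem GU_schemeEnc : GU mp (schemeEnc (y, n, m)) = ones (mp.pm n m).G := by
  simp [GU, stripF_schemeEnc, MParams.pm, MParams.params]

/-- `1^P`. [folklore] -/
theorem PU_schemeEnc : PU mp (schemeEnc (y, n, m)) = ones (mp.pm n m).P := by
  simp [PU, stripF_schemeEnc, MParams.pm, MParams.params]

/-- `1^k`. [folklore] -/
theorem kU_schemeEnc : kU mp (schemeEnc (y, n, m)) = ones (mp.pm n m).k := by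
  simp [kU, stripF_schemeEnc, MParams.pm, MParams.params]

/-- `1^N`. [folklore] -/
theorem NU_schemeEnc : NU mp (schemeEnc (y, n, m)) = ones (mp.pm n m).N := by
  simp [NU, stripF_schemeEnc, MParams.pm, MParams.params]

/-- `1^τ`. [folklore] -/
theorem τU_schemeEnc : τU mp (schemeEnc (y, n, m)) = ones (mp.pm n m).τ := by
  simp [τU, stripF_schemeEnc, MParams.pm, MParams.params]

/-- `1^{kP}`. [folklore] -/
theorem kPU_schemeEnc : kPU mp (schemeEnc (y, n, m)) = ones ((mp.pm n m).k * (mp.pm n m).P) := by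
  simp only [kPU, Function.comp_apply, fanoutFn_apply, kU_schemeEnc, PU_schemeEnc, umulFn_boolPair]

/-- `1^L`. [folklore] -/
theorem LU_schemeEnc : LU mp (schemeEnc (y, n, m)) = ones (mp.pm n m).L := by
  rw [LU, cnU_schemeEnc, kPU_schemeEnc]
  simp only [ones, List.replicate_append_replicate, Params.L]
  rw [show ∀ a b : ℕ, 1 + a + b = (a + b) + 1 from fun a b => by ring, List.replicate_succ]

/-- `1^{testLen}`. [folklore] -/
theorem testLenU_schemeEnc : testLenU mp (schemeEnc (y, n, m)) = ones (mp.pm n m).testLen := by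
  simp only [testLenU, Function.comp_apply, fanoutFn_apply, PU_schemeEnc, NU_schemeEnc, LU_schemeEnc, umulFn_apply,
    fstF_boolPair, sndF_boolPair, List.length_cons, List.length_replicate, Params.testLen]

end Values

/-- All unary parameter bricks are in `FP`. [folklore] -/
theorem nU_mem_FP : nU ∈ FP := comp_mem_FP fstF_mem_FP sndF_mem_FP

/-- `stripF ∈ FP`. [folklore] -/
theorem stripF_mem_FP : stripF ∈ FP := fanoutFn_mem_FP (const_mem_FP _) sndF_mem_FP

/-- `polyFn Q ∘ stripF ∈ FP`. [folklore] -/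
theorem polyFn_stripF_mem_FP (Q : Polynomial ℕ) : polyFn Q ∘ stripF ∈ FP := comp_mem_FP (polyFn_mem_FP Q) stripF_mem_FP

/-- `cnU ∈ FP`. [folklore] -/
theorem cnU_mem_FP : cnU mp ∈ FP := comp_mem_FP (polyFn_mem_FP _) nU_mem_FP

/-- `kPU ∈ FP`. [folklore] -/
theorem kPU_mem_FP : kPU mp ∈ FP :=
  comp_mem_FP umulFn_mem_FP (fanoutFn_mem_FP (polyFn_stripF_mem_FP _) (polyFn_stripF_mem_FP _))

/-- `LU ∈ FP`. [folklore] -/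
theorem LU_mem_FP : LU mp ∈ FP := comp_mem_FP (cons_mem_FP true) (append_mem_FP (cnU_mem_FP mp) (kPU_mem_FP mp))

/-- `testLenU ∈ FP`. [folklore] -/
theorem testLenU_mem_FP : testLenU mp ∈ FP :=
  comp_mem_FP umulFn_mem_FP (fanoutFn_mem_FP
    (comp_mem_FP umulFn_mem_FP (fanoutFn_mem_FP (comp_mem_FP (cons_mem_FP true) (polyFn_stripF_mem_FP _))
      (polyFn_stripF_mem_FP _)))
    (LU_mem_FP mp))

/-! ### Padded query words -/

/-- On `⟨y', e⟩`: the unpadded query word `⟨y', ⟨1ⁿ, 1⁰⟩⟩`. [BogdanovTrevisan2006, Lemma 3.2 (proof)] -/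
def s0F : List Bool → List Bool := fanoutFn fstF (fanoutFn (nU ∘ sndF) fun _ => [])

/-- On `⟨y', e⟩`: **the padded query word** `⟨y', ⟨1ⁿ, 1^{G − |⟨y', ⟨1ⁿ, 1⁰⟩⟩|}⟩⟩`.
[BogdanovTrevisan2006, Lemma 3.2 (proof)] -/
def qOfF : List Bool → List Bool :=
  fanoutFn fstF (fanoutFn (nU ∘ sndF) (dropFn ∘ fanoutFn s0F (GU mp ∘ sndF)))

/-- **Value of the padded query word**: `schemeEnc (query G n y')`. [folklore] -/
theorem qOfF_apply (y' y : List Bool) (n m : ℕ) :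
    qOfF mp (boolPair y' (schemeEnc (y, n, m))) = schemeEnc (query (mp.pm n m).G n y') := by
  have hs0 : s0F (boolPair y' (schemeEnc (y, n, m))) = schemeEnc (y', n, 0) := by
    simp only [s0F, nU, schemeEnc, fanoutFn_apply, Function.comp_apply, fstF_boolPair, sndF_boolPair]
    rfl
  rw [qOfF]
  simp only [fanoutFn_apply, Function.comp_apply, fstF_boolPair, sndF_boolPair, hs0, GU_schemeEnc, dropFn_boolPair,
    nU_schemeEnc]
  simp only [query, padM, schemeEnc, OracleCompose.unaryEncodeNat_eq_replicate, List.drop_replicate]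

/-- `qOfF ∈ FP`. [folklore] -/
theorem qOfF_mem_FP : qOfF mp ∈ FP :=
  fanoutFn_mem_FP fstF_mem_FP (fanoutFn_mem_FP (comp_mem_FP nU_mem_FP sndF_mem_FP)
    (comp_mem_FP dropFn_mem_FP (fanoutFn_mem_FP
      (fanoutFn_mem_FP fstF_mem_FP (fanoutFn_mem_FP (comp_mem_FP nU_mem_FP sndF_mem_FP) (const_mem_FP _)))
      (comp_mem_FP (polyFn_stripF_mem_FP _) sndF_mem_FP))))

/-! ### Sample blocks and the error bit, on `z = ⟨⟨⟨e, R⟩, 1ᶜ⟩, 1ⁱ⟩` -/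

/-- `z ↦ e`. [folklore] -/
def eZ : List Bool → List Bool := fstF ∘ fstF ∘ fstF

/-- `z ↦ R`. [folklore] -/
def rZ : List Bool → List Bool := sndF ∘ fstF ∘ fstF

/-- `z ↦ 1ᶜ`. [folklore] -/
def cZ : List Bool → List Bool := sndF ∘ fstF

/-- `z ↦ 1^{(cN + i) L}` (offset of sample block `i` of candidate `c`). [folklore] -/
def offZ : List Bool → List Bool :=
  umulFn ∘ fanoutFn (fun z => (umulFn ∘ fanoutFn cZ (NU mp ∘ eZ)) z ++ sndF z) (LU mp ∘ eZ)

/-- `z ↦ blockAt c i R`. [folklore] -/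
def blkZ : List Bool → List Bool := takeFn ∘ fanoutFn (LU mp ∘ eZ) (dropFn ∘ fanoutFn (offZ mp) rZ)

/-- `z ↦` the block without its label bit. [folklore] -/
def tailBlkZ : List Bool → List Bool := List.tail ∘ blkZ mp

/-- `z ↦ ⟨1ⁿ, r⟩`, the argument of the sampler (`r` = the `c(n)` coins after the label bit). [folklore] -/
def sampArgZ : List Bool → List Bool := fanoutFn (nU ∘ eZ) (takeFn ∘ fanoutFn (cnU mp ∘ eZ) (tailBlkZ mp))

/-- `z ↦` the amplification coins of the block (after the label bit and the sampler coins). [folklore] -/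
def ampZ : List Bool → List Bool := dropFn ∘ fanoutFn (cnU mp ∘ eZ) (tailBlkZ mp)

variable (S : Bool → RandAlg ℕ (List Bool)) (A : RandAlg (List Bool × ℕ × ℕ) Bool)

/-- `z ↦` **the labelled instance** `S_b(1ⁿ; r)` of the block (branch on the label bit `b` between the two
uniform samplers). [BogdanovTrevisan2006, Def. 2.1] -/
def instZ : List Bool → List Bool :=
  iteFn (headBitFn ∘ blkZ mp) (runStr (S true) ∘ sampArgZ mp) (runStr (S false) ∘ sampArgZ mp)

/-- `z ↦ ⟨padded query of the instance, ⟨1ᶜ, ⟨1ᵏ, amplification coins⟩⟩⟩`, the argument of `majF`. [folklore] -/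
def majArgZ : List Bool → List Bool :=
  fanoutFn (qOfF mp ∘ fanoutFn (instZ mp S) eZ) (fanoutFn cZ (fanoutFn (kU mp ∘ eZ) (ampZ mp)))

/-- **The error bit** of candidate `c` on sample `i`: its majority vote differs from the label bit.
[ImpagliazzoWigderson2001, Lemma 14 (proof)] -/
def errPieceZ : List Bool → List Bool := xorFn (majF A ∘ majArgZ mp S) (headBitFn ∘ blkZ mp)

/-- Dropping after the tail. [folklore] -/
theorem tail_drop_eq (l : List Bool) (a : ℕ) : l.tail.drop a = l.drop (1 + a) := by
  rw [← List.drop_drop, List.drop_one]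

/-- Exclusive or is the inequality test. [folklore] -/
theorem xor_eq_decide_ne (b b' : Bool) : xor b b' = decide (b ≠ b') := by
  cases b <;> cases b' <;> rfl

section ZValues

variable (y R : List Bool) (n m c i : ℕ)

/-- Value of `blkZ`: the sample block. [folklore] -/
theorem blkZ_apply : blkZ mp (boolPair (boolPair (boolPair (schemeEnc (y, n, m)) R) (ones c)) (ones i)) =
    blockAt (mp.pm n m) c i R := by
  simp only [blkZ, offZ, eZ, rZ, cZ, Function.comp_apply, fanoutFn_apply, fstF_boolPair, sndF_boolPair,
    LU_schemeEnc, NU_schemeEnc, umulFn_apply, List.length_append, List.length_replicate, takeFn_boolPair,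
    dropFn_boolPair, blockAt]

/-- Value of `sampArgZ`: `⟨1ⁿ, r⟩`. [folklore] -/
theorem sampArgZ_apply : sampArgZ mp (boolPair (boolPair (boolPair (schemeEnc (y, n, m)) R) (ones c)) (ones i)) =
    boolPair (ones n) (((blockAt (mp.pm n m) c i R).drop 1).take
      (mp.pm n m).cn) := by
  simp only [sampArgZ, tailBlkZ, eZ, Function.comp_apply, fanoutFn_apply, fstF_boolPair, nU_schemeEnc, cnU_schemeEnc,
    blkZ_apply, takeFn_boolPair, List.length_replicate, List.drop_one]

/-- Value of `ampZ`: the amplification coins. [folklore] -/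
theorem ampZ_apply : ampZ mp (boolPair (boolPair (boolPair (schemeEnc (y, n, m)) R) (ones c)) (ones i)) =
    (blockAt (mp.pm n m) c i R).drop (1 + (mp.pm n m).cn) := by
  simp only [ampZ, tailBlkZ, eZ, Function.comp_apply, fanoutFn_apply, fstF_boolPair, cnU_schemeEnc, blkZ_apply,
    dropFn_boolPair, List.length_replicate, tail_drop_eq]

/-- Value of `instZ`: the labelled instance `inst`. [folklore] -/
theorem instZ_apply : instZ mp S (boolPair (boolPair (boolPair (schemeEnc (y, n, m)) R) (ones c)) (ones i)) =
    inst S n (mp.pm n m).cn (blockAt (mp.pm n m) c i R) := by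
  have hhd : (headBitFn ∘ blkZ mp) (boolPair (boolPair (boolPair (schemeEnc (y, n, m)) R) (ones c)) (ones i)) =
      [(blockAt (mp.pm n m) c i R).headD false] := by
    rw [Function.comp_apply, blkZ_apply, headBitFn_apply]
  rw [instZ, iteFn_apply hhd, inst]
  cases (blockAt (mp.pm n m) c i R).headD false <;>
    simp [runStr, sampArgZ_apply]

/-- **Value of the error bit**: `[errBit c (blockAt c i R)]`. [folklore] -/
theorem errPieceZ_apply : errPieceZ mp S A (boolPair (boolPair (boolPair (schemeEnc (y, n, m)) R) (ones c)) (ones i)) =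
    [errBit A S (mp.pm n m) c (blockAt (mp.pm n m) c i R)] := by
  set pm := mp.pm n m with hpm
  have hmaj : (majF A ∘ majArgZ mp S) (boolPair (boolPair (boolPair (schemeEnc (y, n, m)) R) (ones c)) (ones i)) =
      [maj A (query pm.G n (inst S n pm.cn (blockAt pm c i R))) c pm.k ((blockAt pm c i R).drop (1 + pm.cn))] := by
    rw [Function.comp_apply, majArgZ, fanoutFn_apply, fanoutFn_apply, fanoutFn_apply, Function.comp_apply,
      fanoutFn_apply, instZ_apply, ampZ_apply]
    simp only [eZ, cZ, Function.comp_apply, fstF_boolPair, sndF_boolPair, qOfF_apply, kU_schemeEnc, majF_apply, ← hpm]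
  have hhd : (headBitFn ∘ blkZ mp) (boolPair (boolPair (boolPair (schemeEnc (y, n, m)) R) (ones c)) (ones i)) =
      [(blockAt pm c i R).headD false] := by
    rw [Function.comp_apply, blkZ_apply, headBitFn_apply]
  rw [errPieceZ, xorFn_apply hmaj hhd, errBit, xor_eq_decide_ne]
  rfl

end ZValues

/-- `errPieceZ` is one-bit on every input. [folklore] -/
theorem oneBit_errPieceZ : OneBit (errPieceZ mp S A) :=
  oneBit_xorFn ((oneBit_majF A).comp _) (oneBit_headBitFn.comp _)

variable {S A}

/-- `blkZ ∈ FP`. [folklore] -/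
theorem blkZ_mem_FP : blkZ mp ∈ FP := by
  have heZ : eZ ∈ FP := comp_mem_FP fstF_mem_FP (comp_mem_FP fstF_mem_FP fstF_mem_FP)
  have hrZ : rZ ∈ FP := comp_mem_FP sndF_mem_FP (comp_mem_FP fstF_mem_FP fstF_mem_FP)
  have hcZ : cZ ∈ FP := comp_mem_FP sndF_mem_FP fstF_mem_FP
  have hoff : offZ mp ∈ FP :=
    comp_mem_FP umulFn_mem_FP (fanoutFn_mem_FP
      (append_mem_FP (comp_mem_FP umulFn_mem_FP (fanoutFn_mem_FP hcZ (comp_mem_FP (polyFn_stripF_mem_FP _) heZ))) sndF_mem_FP)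
      (comp_mem_FP (LU_mem_FP mp) heZ))
  exact comp_mem_FP takeFn_mem_FP (fanoutFn_mem_FP (comp_mem_FP (LU_mem_FP mp) heZ)
    (comp_mem_FP dropFn_mem_FP (fanoutFn_mem_FP hoff hrZ)))

/-- `sampArgZ ∈ FP`. [folklore] -/
theorem sampArgZ_mem_FP : sampArgZ mp ∈ FP := by
  have heZ : eZ ∈ FP := comp_mem_FP fstF_mem_FP (comp_mem_FP fstF_mem_FP fstF_mem_FP)
  exact fanoutFn_mem_FP (comp_mem_FP nU_mem_FP heZ) (comp_mem_FP takeFn_mem_FP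
    (fanoutFn_mem_FP (comp_mem_FP (cnU_mem_FP mp) heZ) (comp_mem_FP PRelSigma.tail_mem_FP (blkZ_mem_FP mp))))

/-- `ampZ ∈ FP`. [folklore] -/
theorem ampZ_mem_FP : ampZ mp ∈ FP := by
  have heZ : eZ ∈ FP := comp_mem_FP fstF_mem_FP (comp_mem_FP fstF_mem_FP fstF_mem_FP)
  exact comp_mem_FP dropFn_mem_FP
    (fanoutFn_mem_FP (comp_mem_FP (cnU_mem_FP mp) heZ) (comp_mem_FP PRelSigma.tail_mem_FP (blkZ_mem_FP mp)))

/-- `instZ ∈ FP` for polynomial-time samplers. [AroraBarak2009, §1.3] -/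
theorem instZ_mem_FP (hS : ∀ b, (S b).IsPolyTime unaryEncodeNat (id : List Bool → List Bool)) : instZ mp S ∈ FP := by
  have h1 : runStr (S true) ∘ sampArgZ mp ∈ FP := comp_mem_FP (runStr_mem_FP (hS true)) (sampArgZ_mem_FP mp)
  have h0 : runStr (S false) ∘ sampArgZ mp ∈ FP := comp_mem_FP (runStr_mem_FP (hS false)) (sampArgZ_mem_FP mp)
  have hc : headBitFn ∘ blkZ mp ∈ FP := comp_mem_FP HashBricks.headBitFn_mem_FP (blkZ_mem_FP mp)
  unfold instZ
  exact iteFn_mem_FP hc h1 h0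

/-- **`errPieceZ ∈ FP`** for polynomial-time samplers and scheme. [AroraBarak2009, §1.3] -/
theorem errPieceZ_mem_FP (hS : ∀ b, (S b).IsPolyTime unaryEncodeNat (id : List Bool → List Bool))
    (hA : A.IsPolyTime schemeEnc encodeBool) : errPieceZ mp S A ∈ FP := by
  have heZ : eZ ∈ FP := comp_mem_FP fstF_mem_FP (comp_mem_FP fstF_mem_FP fstF_mem_FP)
  have hcZ : cZ ∈ FP := comp_mem_FP sndF_mem_FP fstF_mem_FP
  have hinst : instZ mp S ∈ FP := instZ_mem_FP mp hS
  have harg : majArgZ mp S ∈ FP := by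
    unfold majArgZ
    exact fanoutFn_mem_FP (comp_mem_FP (qOfF_mem_FP mp) (fanoutFn_mem_FP hinst heZ))
      (fanoutFn_mem_FP hcZ (fanoutFn_mem_FP (comp_mem_FP (polyFn_stripF_mem_FP _) heZ) (ampZ_mem_FP mp)))
  have hm : majF A ∘ majArgZ mp S ∈ FP := comp_mem_FP (majF_mem_FP hA) harg
  have hh : headBitFn ∘ blkZ mp ∈ FP := comp_mem_FP HashBricks.headBitFn_mem_FP (blkZ_mem_FP mp)
  unfold errPieceZ
  exact xorFn_mem_FP hm hh

end AdviceElim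

/-- **Registered sub-goal of this file**: the value of the error-bit brick on a well-formed argument
(`AdviceElim.errPieceZ_apply`). [ImpagliazzoWigderson2001, Lemma 14 (proof)] -/
theorem adviceElim_errPieceZ_apply (mp : AdviceElim.MParams) (S : Bool → RandAlg ℕ (List Bool))
    (A : RandAlg (List Bool × ℕ × ℕ) Bool) (y R : List Bool) (n m c i : ℕ) :
    AdviceElim.errPieceZ mp S A (boolPair (boolPair (boolPair (schemeEnc (y, n, m)) R) (List.replicate c true))
      (List.replicate i true)) = [AdviceElim.errBit A S (mp.pm n m) c (AdviceElim.blockAt (mp.pm n m) c i R)] :=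
  AdviceElim.errPieceZ_apply mp S A y R n m c i

end Summit.PneNP.PneNP.Cruxes.PeaWorstToAvg.DualModeCompile

end
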